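import Summits.BirchSwinnertonDyer.Rank1Residual.P2.CongruentNumberThetaDescentBlocks
import HarnessLib
import HarnessLib.Audit.Tags

/-!
# Cell «bsd-monsky» (prover-B): route B's operator `θ` for ALL square-free `n ≡ 6 (mod 8)` — the UNIFORM Θ-criterion,
# part 1: the cosets `b·w + ℤτ(1)`, residues along the recursion, square-root bookkeeping, (E5) for composite `5`-blocks
# (kernel lemmas; nothing asserted, nothing booked)

HONEST FRAMING (cell `bsd-monsky`, run/shared/lean/pub/bsd-monsky/; README §1/§3): the cell's CLAIMED theorem is Monsky's 1990
conjecture on the `k = 2` family `𝒮⁻`; «ℓ ≥ 3 rungs (C-P2-2 for k ≥ 3) are NOT claimed — record what the same argument gives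
there, no more». THIS FILE IS PART OF THAT RECORD IN THE KERNEL, in its FINAL, UNIFORM form: the Θ-criterion of the scope note
HOME/proof/PROOF-B-K3-SCOPE.md §3 (prover-B g6) for ALL square-free `n ≡ 6 (mod 8)` at once — route B's «Tian induction on the
number of prime factors» — instead of one descent file per `k = 3` type (g8: `P2/CongruentNumberThetaThreePrimes*.lean`).
Nothing is asserted: every statement is a kernel implication from the displayed printed sentences of
`Literature/…/TianYuanZhang2017/GenusPointDescentDisplays.lean` (`recursion`, `epsSpec`, `thm35Main`, `lemma318`, `scriptLSpec`)
and `…/CMPointGaloisDisplays.lean` (`CMBlockSpec`, `ThetaBlockSpec`, `SevenBlockSpec`, `ConjSpec` — TYZ §3.1–3.2 / Prop. 3.2 /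
Thm. 3.6 / p. 759 AS PRINTED, every block) taken as data/hypotheses (the hypotheses the named fact `tyz_cmPointGaloisData`
provides); no conjecture is discharged, no count moves, no class is booked. NOT refereed; not part of PROOF-B v1.3 or of the paper.
No new definition is introduced: the control condition, the coset predicate and the Θ-certificate are written out in full.

THE CRITERION (three files: `…ThetaCriterionCosets` = cosets, residues, square-root bookkeeping, (E5) for composite blocks;
`…ThetaCriterionPackage` = the `θ`-package for general `n`; `…ThetaCriterion` = the block induction and the theorem).
Let `n ≡ 6 (mod 8)` be square-free, `θ = θ^{(n)}` the top block's lift of `σ_{1+ϖ}` (display (G8)), `w = τ((1−i)/2)` (`2w = 0`,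
`θw + w = τ(1)`). TYZ's recursion `P(d) = Z(d) − Σ_{d₀ ∈ R(d)} ε(d₀, d/d₀)𝓛(d/d₀)P(d₀)` runs over blocks `d ∣ n`, `d ≡ 5, 6, 7
(mod 8)`; from a `6`-block the steps (block, cofactor mod 8) are `(6,1)` and `(7,2)`, from a `7`-block `(7,1)` and `(5,3)`
(`ε = ±i`), from a GOOD `5`-block (all primes `≡ 1 (mod 4)`) only `(5,1)` to good `5`-blocks. Block evaluations: (E6)
`(θ−1)Z(d) ∈ g(d)w + ℤτ(1)` for every `6`-block (J759: compare `θ^{(n)}` with `θ^{(d)}`); (E7) `(θ−1)Z(d) = 0` for every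
`7`-block (Prop. 3.2 (3)); (E5) `(θ+1)Z(d) ∈ ℤτ(1)` for every good `5`-block (Thm. 3.6 (1) + `c` inverting `Cl′_d`); and
`(θ ∓ 1)∘[i] = −[i]∘(θ ± 1)`. CONTROL in closed form: `n` is `θ`-controlled iff every `7`-block `d₀ ∣ n` with `n/d₀ ≡ 2
(mod 8)` has only good `5`-divisors (the `[3,3,7]` obstruction of the scope census and nothing else; always at `k = 2`).
VALUE: a Θ-certificate `s : ℕ → ℤ/2` with `s(e) = g(e) + Σ_{d₀ ∈ R(e), d₀ ≡ 6} 𝓛(e/d₀)s(d₀)` on the `6`-blocks `e ∣ n` with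
`n/e ≡ 1 (mod 8)` (`Θ(n) := s(n)` = the sum over chains of `6`-blocks of `(∏𝓛)·g`). THEOREM (`odd_scriptL_of_thetaCert`):
`θ`-controlled, `Θ(n) = 1`, rank `E_n(ℚ) ≤ 1` once `𝓛(n) ≠ 0` ⟹ `𝓛(n)` odd; hence `ord_{s=1} L(E_n, s) = 1` from the display
ALONE (`analyticRank_eq_one_of_thetaCert_of_cmPointGaloisData`). Instances: THEOREM B (`k = 2`, `Θ = g(2pq)`), g8's
THEOREM B₃ for `(5,5,7)` (`Θ = g(n) + 𝓛(p₁p₂)g(2p₃)`) and `(3,7,7)`.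

References: [TianYuanZhang2017] §3.1 (J738–J739), Prop. 3.2 (1)(2)(3), Thm. 3.3 (ε), Thm. 3.5, Thm. 3.6 (1)(2) (J741),
Lemma 3.18, proofs of Lemma 3.15 (J750) and Lemma 3.21 (J759), §2.1 (J725); HOME/proof/PROOF-B.md v1.3 §4–§8, §10;
HOME/proof/PROOF-B-K3-SCOPE.md §2–§5; HOME/proof/PROOF-B-THETA-CRITERION.md (this generation's companion note).

THIS FILE: §1 the cosets «`x ∈ b·w + ℤτ(1)`» = `∃ M : ℤ, x = b • w + M • τ(1)` and their algebra (sums, `𝓛 •`, `[i]^e`,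
`b mod 2`); §1b `θ + 1` past `[i]^e`; §2 good `5`-blocks, the recursion index unpacked, the residue bookkeeping of the
steps; §3 two automorphisms agreeing on `i` and on the `√−p` (`p ∣ d` prime) agree on every `√−d′`, `d′ ∣ d`; §4 (E5) for
every GOOD `5`-block (g8's `theta_Z_add_Z_mem_of_five` was the prime case).
-/

noncomputable section

open scoped Classical

open WeierstrassCurve WeierstrassCurve.Affine Literature.NumberTheory.EllipticCurves
  Literature.NumberTheory.EllipticCurves.Rank1Residual
  Literature.NumberTheory.EllipticCurves.Rank1Residual.Typed
  Literature.NumberTheory.EllipticCurves.TianYuanZhang2017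
  Literature.NumberTheory.EllipticCurves.TianYuanZhang2017.W2

set_option autoImplicit false

namespace Summit.BirchSwinnertonDyer.Rank1Residual.P2

namespace ThetaDescent

variable {n : ℕ}

/-! ## §1 The cosets `b·w + ℤτ(1)` (`w = τ((1−i)/2)`, `2w = 0`): `∃ M : ℤ, x = b • w + M • τ(1)` -/

/-- `0 ∈ 0·w + ℤτ(1)`. [cite: TianYuanZhang2017, §3.2 (p0012 L8–L18)] -/
theorem inW_zero (D : GenusPointData n) : ∃ M : ℤ, (0 : APoint D.H) = (0 : ℤ) • D.tauHalfOneMinusI + M • tauOne :=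
  ⟨0, by simp⟩

/-- An element of `ℤτ(1)` lies in `0·w + ℤτ(1)`. [cite: TianYuanZhang2017, Lemma 3.16 (p0017 L105–L113)] -/
theorem inW_zero_of_mem (D : GenusPointData n) {x : APoint D.H}
    (hx : x ∈ AddSubgroup.zmultiples (tauOne : APoint D.H)) :
    ∃ M : ℤ, x = (0 : ℤ) • D.tauHalfOneMinusI + M • tauOne := by
  obtain ⟨k, hk⟩ := exists_eq_zsmul_of_mem_zmultiples_tauOne D hx
  exact ⟨k, by rw [hk, zero_smul, zero_add]⟩

/-- Cosets add: `(b₁w + ℤτ(1)) + (b₂w + ℤτ(1)) ⊆ (b₁ + b₂)w + ℤτ(1)`. [cite: TianYuanZhang2017, §3.2 (p0012 L8–L18)] -/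
theorem inW_add (D : GenusPointData n) {b₁ b₂ : ℤ} {x₁ x₂ : APoint D.H}
    (h₁ : ∃ M : ℤ, x₁ = b₁ • D.tauHalfOneMinusI + M • tauOne) (h₂ : ∃ M : ℤ, x₂ = b₂ • D.tauHalfOneMinusI + M • tauOne) :
    ∃ M : ℤ, x₁ + x₂ = (b₁ + b₂) • D.tauHalfOneMinusI + M • tauOne := by
  obtain ⟨M₁, rfl⟩ := h₁
  obtain ⟨M₂, rfl⟩ := h₂
  exact ⟨M₁ + M₂, by rw [add_smul, add_smul]; abel⟩

/-- Cosets are symmetric: `−(b·w + ℤτ(1)) = b·w + ℤτ(1)` (`2w = 0`). [cite: TianYuanZhang2017, §3.2 (p0012 L8–L18)] -/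
theorem inW_neg (D : GenusPointData n) {b : ℤ} {x : APoint D.H} (h : ∃ M : ℤ, x = b • D.tauHalfOneMinusI + M • tauOne) :
    ∃ M : ℤ, -x = b • D.tauHalfOneMinusI + M • tauOne := by
  obtain ⟨M, rfl⟩ := h
  have h2 : (2 : ℕ) • D.tauHalfOneMinusI = 0 := (tau_facts D).2.2.2.1
  refine ⟨-M - 0, ?_⟩
  have hw : -(D.tauHalfOneMinusI) = D.tauHalfOneMinusI := by
    rw [neg_eq_iff_add_eq_zero, ← two_nsmul, h2]
  rw [neg_add, ← smul_neg, hw, sub_zero, neg_smul]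

/-- Cosets subtract. [cite: TianYuanZhang2017, §3.2 (p0012 L8–L18)] -/
theorem inW_sub (D : GenusPointData n) {b₁ b₂ : ℤ} {x₁ x₂ : APoint D.H}
    (h₁ : ∃ M : ℤ, x₁ = b₁ • D.tauHalfOneMinusI + M • tauOne) (h₂ : ∃ M : ℤ, x₂ = b₂ • D.tauHalfOneMinusI + M • tauOne) :
    ∃ M : ℤ, x₁ - x₂ = (b₁ + b₂) • D.tauHalfOneMinusI + M • tauOne := by
  rw [sub_eq_add_neg]
  exact inW_add D h₁ (inW_neg D h₂)

/-- Cosets scale: `L·(b·w + ℤτ(1)) ⊆ (Lb)·w + ℤτ(1)`. [cite: TianYuanZhang2017, §3.1 (p0011 L67–L73)] -/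
theorem inW_zsmul (D : GenusPointData n) {b : ℤ} {x : APoint D.H} (L : ℤ)
    (h : ∃ M : ℤ, x = b • D.tauHalfOneMinusI + M • tauOne) :
    ∃ M : ℤ, L • x = (L * b) • D.tauHalfOneMinusI + M • tauOne := by
  obtain ⟨M, rfl⟩ := h
  exact ⟨L * M, by rw [smul_add, smul_smul, smul_smul]⟩

/-- Cosets are stable under `[i]^k` (`[i]w ∈ w + ℤτ(1)`, `[i]τ(1) = τ(1)`). [cite: TianYuanZhang2017, §3.2 (p0012 L8–L18), Lemma 3.16] -/
theorem inW_cmIPow (D : GenusPointData n) {b : ℤ} {x : APoint D.H} (k : ℕ)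
    (h : ∃ M : ℤ, x = b • D.tauHalfOneMinusI + M • tauOne) :
    ∃ M : ℤ, cmIPow D.im D.im_sq k x = b • D.tauHalfOneMinusI + M • tauOne := by
  obtain ⟨M, rfl⟩ := h
  obtain ⟨j, hj⟩ := cmIPow_tauHalfOneMinusI D k
  refine ⟨b * j + M, ?_⟩
  rw [map_add, map_zsmul, map_zsmul, hj, cmIPow_tauOne, smul_add, smul_smul, add_smul]
  abel

/-- Only `b mod 2` matters (`2w = 0`). [cite: TianYuanZhang2017, §3.2 (p0012 L8–L18)] -/
theorem inW_of_intCast_eq (D : GenusPointData n) {b b' : ℤ} {x : APoint D.H}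
    (h : ∃ M : ℤ, x = b • D.tauHalfOneMinusI + M • tauOne) (hb : (b : ZMod 2) = (b' : ZMod 2)) :
    ∃ M : ℤ, x = b' • D.tauHalfOneMinusI + M • tauOne := by
  obtain ⟨M, rfl⟩ := h
  obtain ⟨k, hk⟩ := (ZMod.intCast_eq_intCast_iff_dvd_sub b b' 2).mp hb
  have h2 : (2 : ℕ) • D.tauHalfOneMinusI = 0 := (tau_facts D).2.2.2.1
  refine ⟨M, ?_⟩
  have hb' : b' = b + 2 * k := by linear_combination hk
  rw [hb', add_smul, mul_comm, ← smul_smul, two_zsmul, ← two_nsmul, h2, smul_zero, add_zero]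

/-- Cosets add over finite sums. [cite: TianYuanZhang2017, §3.1 (p0011 L67–L73)] -/
theorem inW_sum (D : GenusPointData n) {ι : Type*} (s : Finset ι) (b : ι → ℤ) (x : ι → APoint D.H)
    (h : ∀ i ∈ s, ∃ M : ℤ, x i = b i • D.tauHalfOneMinusI + M • tauOne) :
    ∃ M : ℤ, ∑ i ∈ s, x i = (∑ i ∈ s, b i) • D.tauHalfOneMinusI + M • tauOne := by
  induction s using Finset.induction_on with
  | empty => simpa using inW_zero D
  | insert a s ha ih =>
    rw [Finset.sum_insert ha, Finset.sum_insert ha]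
    exact inW_add D (h a (Finset.mem_insert_self a s)) (ih fun i hi => h i (Finset.mem_insert_of_mem hi))

/-! ## §1b `θ + 1` past `[i]^e` (companions of `theta_sub_cmIPow_even/odd`) -/

/-- `θ + 1` commutes with `[i]^e` for `e` even and with `𝓛 •` (`θ(i) = −i`). [cite: TianYuanZhang2017, §3.1 (p0011 L66–L73)] -/
theorem theta_add_cmIPow_even (D : GenusPointData n) (θ : D.H ≃ₐ[ℚ] D.H) (hθi : θ D.im = -D.im) {e : ℕ} (he : Even e)
    (L : ℤ) (X : APoint D.H) :
    thetaPt D θ (cmIPow D.im D.im_sq e (L • X)) + cmIPow D.im D.im_sq e (L • X) =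
      cmIPow D.im D.im_sq e (L • (thetaPt D θ X + X)) := by
  rw [thetaPt_cmIPow D θ hθi, he.neg_one_pow, one_smul, map_zsmul, smul_add, map_add, map_zsmul, map_zsmul]

/-- For `e` odd: `(θ + 1)([i]^e(𝓛•X)) = −[i]^e(𝓛•(θX − X))`. [cite: TianYuanZhang2017, §3.1 (p0011 L66–L73), Thm. 3.3 (ε = ±i)] -/
theorem theta_add_cmIPow_odd (D : GenusPointData n) (θ : D.H ≃ₐ[ℚ] D.H) (hθi : θ D.im = -D.im) {e : ℕ} (he : Odd e)
    (L : ℤ) (X : APoint D.H) :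
    thetaPt D θ (cmIPow D.im D.im_sq e (L • X)) + cmIPow D.im D.im_sq e (L • X) =
      -cmIPow D.im D.im_sq e (L • (thetaPt D θ X - X)) := by
  rw [thetaPt_cmIPow D θ hθi, he.neg_one_pow, neg_smul, one_smul, map_zsmul, smul_sub, map_sub, map_zsmul, map_zsmul]
  abel

/-! ## §2 Arithmetic: the control predicates, the recursion index, residues -/

/-! «GOOD `5`-block» `d`: all prime factors `≡ 1 (mod 4)` — `∀ p ∈ d.primeFactors, p % 4 = 1` (then `θc` is trivial on `L_d(i)`
and (E5) applies); «GOOD `7`-block» `d`: every divisor `≡ 5 (mod 8)` is a good `5`-block; «`θ`-CONTROLLED» `n`: every `7`-block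
`d₀ ∣ n` with `n/d₀ ≡ 2 (mod 8)` is good — `∀ d₀ ∈ n.divisors, d₀ % 8 = 7 → (n / d₀) % 8 = 2 → ∀ d′ ∈ d₀.divisors, d′ % 8 = 5 →
∀ p ∈ d′.primeFactors, p % 4 = 1` (the closed form of the scope note's «no uncontrolled chain»; at `k = 2` always, at `k = 3`
exactly the types other than `[3,3,7]`; decidable for numerals). These are written out in full in every statement (no new
definitions in this file). -/

/-- Good `5`-blocks are closed under divisors. [cite: TianYuanZhang2017, §3.1 (p0011 L67–L70)] -/
theorem fiveGood_of_dvd {d d₀ : ℕ} (h : ∀ p ∈ d.primeFactors, p % 4 = 1) (hd : d ≠ 0) (hd₀ : d₀ ∣ d) :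
    ∀ p ∈ d₀.primeFactors, p % 4 = 1 := fun p hp =>
  h p (Nat.mem_primeFactors.mpr ⟨(Nat.mem_primeFactors.mp hp).1, (Nat.mem_primeFactors.mp hp).2.1.trans hd₀, hd⟩)

/-- A good `5`-block is `≡ 1 (mod 4)` (product of primes `≡ 1 (mod 4)`). [cite: HardyWright2008, §1.3 Thm. 2] -/
theorem fiveGood_mod_four {d : ℕ} (h : ∀ p ∈ d.primeFactors, p % 4 = 1) (hd : d ≠ 0) : d % 4 = 1 := by
  induction d using Nat.strong_induction_on with
  | _ d ih =>
    by_cases h1 : d = 1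
    · subst h1; rfl
    · have hp : d.minFac.Prime := Nat.minFac_prime h1
      have hpd : d.minFac ∣ d := Nat.minFac_dvd d
      have hp4 : d.minFac % 4 = 1 := h _ (Nat.mem_primeFactors.mpr ⟨hp, hpd, hd⟩)
      have he : d = d.minFac * (d / d.minFac) := (Nat.mul_div_cancel' hpd).symm
      have hq0 : d / d.minFac ≠ 0 := by
        intro h0; rw [h0, mul_zero] at he; exact hd he
      have hqlt : d / d.minFac < d := Nat.div_lt_self (Nat.pos_of_ne_zero hd) hp.one_lt
      have hq4 : (d / d.minFac) % 4 = 1 := ih _ hqlt (fiveGood_of_dvd h hd ⟨d.minFac, by rw [mul_comm]; exact he⟩) hq0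
      rw [he, Nat.mul_mod, hp4, hq4]

/-- Membership in the recursion index, unfolded. [cite: TianYuanZhang2017, §3.1 (p0011 L67–L70)] -/
theorem mem_recursionIndex_iff {d d₀ : ℕ} : d₀ ∈ recursionIndex d ↔
    d₀ ∈ d.divisors ∧ (d₀ % 8 = 5 ∨ d₀ % 8 = 6 ∨ d₀ % 8 = 7) ∧
      ((d / d₀) % 8 = 1 ∨ (d / d₀) % 8 = 2 ∨ (d / d₀) % 8 = 3) ∧ 1 < d / d₀ := by
  simp only [recursionIndex, Finset.mem_filter]

/-- A block of the recursion index is a PROPER divisor. [cite: TianYuanZhang2017, §3.1 (p0011 L67–L70)] -/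
theorem lt_of_mem_recursionIndex {d d₀ : ℕ} (h : d₀ ∈ recursionIndex d) : d₀ < d := by
  obtain ⟨hd₀, -, -, hgt⟩ := mem_recursionIndex_iff.mp h
  obtain ⟨hdvd, hd⟩ := Nat.mem_divisors.mp hd₀
  have he : d₀ * (d / d₀) = d := Nat.mul_div_cancel' hdvd
  have hpos : 0 < d₀ := Nat.pos_of_dvd_of_pos hdvd (Nat.pos_of_ne_zero hd)
  nlinarith

/-- Residues multiply along the recursion: `d ≡ d₀ · (d/d₀) (mod 8)`. [cite: TianYuanZhang2017, §3.1 (p0011 L67–L70)] -/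
theorem mod_eight_of_dvd {d d₀ : ℕ} (hdvd : d₀ ∣ d) : d % 8 = (d₀ % 8) * ((d / d₀) % 8) % 8 := by
  conv_lhs => rw [← Nat.mul_div_cancel' hdvd]
  exact Nat.mul_mod _ _ _

/-- The sub-blocks of a `7`-block: `(7, 1)`-steps to `7`-blocks and `(5, 3)`-steps to `5`-blocks.
[cite: TianYuanZhang2017, §3.1 (p0011 L67–L70) and Thm. 3.3 (p0011 L49–L51)] -/
theorem sub_of_seven {d d₀ : ℕ} (hd7 : d % 8 = 7) (h : d₀ ∈ recursionIndex d) :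
    (d₀ % 8 = 7 ∧ (d / d₀) % 8 = 1) ∨ (d₀ % 8 = 5 ∧ (d / d₀) % 8 = 3) := by
  obtain ⟨hd₀, h567, h123, -⟩ := mem_recursionIndex_iff.mp h
  have key := mod_eight_of_dvd (Nat.mem_divisors.mp hd₀).1
  rw [hd7] at key
  rcases h567 with h | h | h <;> rcases h123 with h' | h' | h' <;> rw [h, h'] at key <;> omega

/-- The sub-blocks of a `6`-block: `(6, 1)`-steps to `6`-blocks and `(7, 2)`-steps to `7`-blocks.
[cite: TianYuanZhang2017, §3.1 (p0011 L67–L70)] -/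
theorem sub_of_six {d d₀ : ℕ} (hd6 : d % 8 = 6) (h : d₀ ∈ recursionIndex d) :
    (d₀ % 8 = 6 ∧ (d / d₀) % 8 = 1) ∨ (d₀ % 8 = 7 ∧ (d / d₀) % 8 = 2) := by
  obtain ⟨hd₀, h567, h123, -⟩ := mem_recursionIndex_iff.mp h
  have key := mod_eight_of_dvd (Nat.mem_divisors.mp hd₀).1
  rw [hd6] at key
  rcases h567 with h | h | h <;> rcases h123 with h' | h' | h' <;> rw [h, h'] at key <;> omega

/-- The sub-blocks of a GOOD `5`-block: `(5, 1)`-steps to good `5`-blocks only.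
[cite: TianYuanZhang2017, §3.1 (p0011 L67–L70)] -/
theorem sub_of_fiveGood {d d₀ : ℕ} (hgood : ∀ p ∈ d.primeFactors, p % 4 = 1) (h : d₀ ∈ recursionIndex d) :
    d₀ % 8 = 5 ∧ (d / d₀) % 8 = 1 ∧ ∀ p ∈ d₀.primeFactors, p % 4 = 1 := by
  obtain ⟨hd₀, h567, h123, -⟩ := mem_recursionIndex_iff.mp h
  obtain ⟨hdvd, hd⟩ := Nat.mem_divisors.mp hd₀
  have hq : d / d₀ ∣ d := Nat.div_dvd_of_dvd hdvd
  have h₀ := fiveGood_of_dvd hgood hd hdvd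
  have h₁ := fiveGood_of_dvd hgood hd hq
  have hd₀0 : d₀ ≠ 0 := fun h0 => by rw [h0] at h567; omega
  have hq0 : d / d₀ ≠ 0 := fun h0 => by rw [h0] at h123; omega
  have e₀ := fiveGood_mod_four h₀ hd₀0
  have e₁ := fiveGood_mod_four h₁ hq0
  refine ⟨by omega, by omega, h₀⟩

/-! ## §3 Galois bookkeeping: two automorphisms agreeing on `i` and on `√−p` (`p ∣ d` prime) agree on every `√−d′`, `d′ ∣ d` -/

/-- **Square-root transport along the factorisation** (`√−d′ = ±i·√−p·√−(d′/p)`): if `g` and `h` agree on `i` and on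
`√−p` for every prime `p ∣ d`, they agree on `√−d′` for every divisor `1 < d′` of `d` (`d ∣ n`).
[cite: TianYuanZhang2017, proof of Lemma 3.21 (J759 = p0020 L55–L58: L_n(i) = ℚ(i, √d : d ∣ n))] -/
theorem apply_sqrtNeg_eq_of_forall_prime (D : GenusPointData n) {d : ℕ} (hdn : d ∈ n.divisors)
    (g h : D.H ≃ₐ[ℚ] D.H) (hi : g D.im = h D.im)
    (hp : ∀ p : ℕ, p.Prime → p ∣ d → g (D.sqrtNeg p) = h (D.sqrtNeg p)) :
    ∀ d' : ℕ, d' ∣ d → 1 < d' → g (D.sqrtNeg d') = h (D.sqrtNeg d') := by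
  obtain ⟨hdn', hn0⟩ := Nat.mem_divisors.mp hdn
  intro d'
  induction d' using Nat.strong_induction_on with
  | _ d' ih =>
    intro hd' h1
    have hd'n : d' ∈ n.divisors := Nat.mem_divisors.mpr ⟨hd'.trans hdn', hn0⟩
    have hd'1 : d' ≠ 1 := by omega
    have hd'0 : d' ≠ 0 := by omega
    set p := d'.minFac with hpdef
    have hpp : p.Prime := Nat.minFac_prime hd'1
    have hpd' : p ∣ d' := Nat.minFac_dvd d'
    have hpn : p ∈ n.divisors := Nat.mem_divisors.mpr ⟨hpd'.trans (hd'.trans hdn'), hn0⟩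
    set e := d' / p with hedef
    have he : d' = p * e := (Nat.mul_div_cancel' hpd').symm
    by_cases he1 : e = 1
    · rw [he, he1, mul_one]
      exact hp p hpp (hpd'.trans hd')
    · have he0 : e ≠ 0 := fun h0 => hd'0 (by rw [he, h0, mul_zero])
      have helt : e < d' := Nat.div_lt_self (Nat.pos_of_ne_zero hd'0) hpp.one_lt
      have hed : e ∣ d := (Nat.div_dvd_of_dvd hpd').trans hd'
      have hen : e ∈ n.divisors := Nat.mem_divisors.mpr ⟨hed.trans hdn', hn0⟩
      have hge : g (D.sqrtNeg e) = h (D.sqrtNeg e) := ih e helt hed (Nat.one_lt_iff_ne_zero_and_ne_one.mpr ⟨he0, he1⟩)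
      have hgp : g (D.sqrtNeg p) = h (D.sqrtNeg p) := hp p hpp (hpd'.trans hd')
      -- `(√−d′)² = (i·√−p·√−e)²`
      have hsq : D.sqrtNeg d' ^ 2 = (D.im * D.sqrtNeg p * D.sqrtNeg e) ^ 2 := by
        rw [D.sqrtNeg_sq d' hd'n, mul_pow, mul_pow, D.im_sq, D.sqrtNeg_sq p hpn, D.sqrtNeg_sq e hen, he]
        push_cast; ring
      have hgy : g (D.im * D.sqrtNeg p * D.sqrtNeg e) = h (D.im * D.sqrtNeg p * D.sqrtNeg e) := by
        rw [map_mul, map_mul, map_mul, map_mul, hi, hgp, hge]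
      rcases sq_eq_sq_iff_eq_or_eq_neg.mp hsq with hx | hx
      · rw [hx, hgy]
      · rw [hx, map_neg, map_neg, hgy]

/-- If `g x = h x` for a square root `x` of a rational number, then `g h⁻¹` fixes `x`. [cite: TianYuanZhang2017, §3.1 (p0011 L60–L64)] -/
theorem mul_inv_apply_eq_self_of_apply_eq (D : GenusPointData n) (g h : D.H ≃ₐ[ℚ] D.H) (x : D.H) (r : ℚ)
    (hx : x ^ 2 = (r : D.H)) (he : g x = h x) : (g * h⁻¹) x = x := by
  rw [AlgEquiv.mul_apply]
  rcases apply_eq_self_or_neg_of_sq_eq D h x r hx with hh | hh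
  · rw [inv_apply_of_apply_eq D h x hh, he, hh]
  · rw [inv_apply_eq_neg_of_apply_eq_neg D h hh, map_neg, he, hh, neg_neg]

/-- `√−d′` is a square root of the rational number `−d′`. [cite: TianYuanZhang2017, §3.1 (p0011 L60–L64)] -/
theorem sqrtNeg_sq_ratCast (D : GenusPointData n) {d : ℕ} (hd : d ∈ n.divisors) :
    D.sqrtNeg d ^ 2 = ((-(d : ℚ) : ℚ) : D.H) := by
  rw [D.sqrtNeg_sq d hd]; push_cast; ring

/-! ## §4 (E5) for every GOOD `5`-block (composite allowed) -/

/-- **(E5) for a good `5`-block `d`** (PROOF-B (B3) = `reflection_sum_thetaPt`, fed with the display's block-`d` sentences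
(G1)–(G7), (G5) and `c² = 1`): if `θ′·c` is trivial on `L_d(i)` then `θ′·Z(d) + Z(d) ∈ ℤτ(1)`.
[cite: TianYuanZhang2017, Thm. 3.6 (1) (J741 = p0012 L27–L29), proof of Lemma 3.15 (J750), proof of Lemma 3.21 (J759 = p0020 L55–L62)] -/
theorem theta_Z_add_Z_mem_of_fiveGood (D : GenusPointData n) {d : ℕ} (hdn : d ∈ n.divisors) (hd5 : d % 8 = 5)
    (hgood : ∀ p ∈ d.primeFactors, p % 4 = 1) {zd : APoint D.H} {Φd : Finset (D.H ≃ₐ[ℚ] D.H)} {Γd Γd' : Subgroup (D.H ≃ₐ[ℚ] D.H)}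
    {σd c : D.H ≃ₐ[ℚ] D.H} (hB : D.CMBlockSpec d zd Φd Γd Γd' σd c) (hcc : c * c = 1) (θ' : D.H ≃ₐ[ℚ] D.H)
    (hα : D.TrivialOnL d (θ' * c)) :
    thetaPt D θ' (D.Z d) + D.Z d ∈ AddSubgroup.zmultiples (tauOne : APoint D.H) := by
  obtain ⟨⟨hZ, -⟩, hΦ, ⟨hΓz, hΓn, habp⟩, ⟨-, hΓgen⟩, ⟨hdih, hcz5, -⟩, ⟨hσH, hσσ, hσz⟩, ⟨hrep, huniq⟩⟩ := hB
  obtain ⟨hddvd, hn0⟩ := Nat.mem_divisors.mp hdn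
  have hd0 : d ≠ 0 := fun h => by rw [h] at hd5; omega
  have hd1 : 1 < d := by omega
  have hdodd : Odd d := Nat.odd_iff.mpr (by omega)
  have hdd : d ∈ d.divisors := Nat.mem_divisors_self _ hd0
  have hcz : thetaPt D c zd = -zd + tauOne := hcz5 hd5
  have hΓz' : ∀ γ ∈ Γd', thetaPt D γ zd = zd := fun γ hγ => hΓz γ hγ
  have hσz' : thetaPt D σd zd = zd + tauOne := hσz
  -- genus roots of the (odd, `≡ 1 (mod 4)`) divisors of `d`
  have hgr : ∀ d' ∈ d.divisors, D.genusRoot d' = D.im * D.sqrtNeg d' := by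
    intro d' hd'
    obtain ⟨hd'd, -⟩ := Nat.mem_divisors.mp hd'
    have h4 : d' % 4 = 1 :=
      fiveGood_mod_four (fiveGood_of_dvd hgood hd0 hd'd) (fun h0 => hd0 (Nat.eq_zero_of_zero_dvd (h0 ▸ hd'd)))
    unfold GenusPointData.genusRoot; rw [if_pos h4]
  -- `σ` is trivial on `L_d(i)`
  obtain ⟨hσsd, hσgen⟩ := hΓgen σd hσH
  have hσrd : σd (D.im * D.sqrtNeg d) = D.im * D.sqrtNeg d := by rw [← hgr d hdd]; exact hσgen d hdd hdodd hd1
  have hσi : σd D.im = D.im := fix_im_of_fix_mul D σd (sqrtNeg_ne_zero D hdn) hσsd hσrd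
  have hFσ : D.TrivialOnL d σd := by
    refine ⟨hσi, fun d' hd' h1' => ?_⟩
    have hd'odd : Odd d' := hdodd.of_dvd_nat (Nat.mem_divisors.mp hd').1
    have := hσgen d' hd' hd'odd h1'
    rw [hgr d' hd'] at this
    exact fix_of_fix_im_mul D σd hσi _ this
  -- the abstract reflection lemma with `F` = "trivial on `L_d(i)`"
  have hFsp : ∀ a, D.TrivialOnL d a → a (D.sqrtNeg d) = D.sqrtNeg d := fun a ha => ha.2 d hdd hd1
  have hcomm : ∀ s t, D.TrivialOnL d s → D.TrivialOnL d t → s⁻¹ * t⁻¹ * s * t ∈ Γd' := fun s t hs ht =>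
    habp s t (hFsp s hs) (hFsp t ht)
  have hct : ∀ t, D.TrivialOnL d t → c * t * c * t ∈ Γd' := fun t ht => hdih t (hFsp t ht)
  have hg : θ' = θ' * c * c := by rw [mul_assoc, hcc, mul_one]
  obtain ⟨m, hm⟩ := reflection_sum_thetaPt D Γd' zd hΓn hΓz' (D.TrivialOnL d) (fun a b => trivialOnL_mul D)
    (fun a => trivialOnL_inv D) hcomm hFσ hσσ hσz' Φd hΦ hrep huniq hcc hct hcz (θ' * c) hα
  have hZ' : D.Z d = ∑ t ∈ Φd, thetaPt D t zd := hZ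
  refine mem_zmultiples_tauOne_of_eq_zsmul D (k := m) ?_
  rw [hZ', hg]; exact hm

end ThetaDescent

end Summit.BirchSwinnertonDyer.Rank1Residual.P2

end
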